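import Summits.QuantumFields.YangMills.Theorems.UnitScaleTiltProp8ChartQuadratic
import HarnessLib

/-!
# Route `UnitScaleTilt`, crux K1 «MinimiserStabilityRegPr» (stmt-QuantumFields-19200), leaf V2′ `stub_halvingStep` — pillar P3 `ChartPerLevel`:
# **THE P3 TEXT `ChartRemainderAt` REDUCED TO ITS THIRD CONJUNCT (hH)** — hCd and hCq by name (p551634, p552175), with constants depending on `L` only

Cell `ym3-torus` ∕ fleet seat `ym-ust-19200-p2` g6 (v8 PEN).  The registered-to-be pillar text `Prop8Chart.ChartRemainderAt L R₀ M₀ C₂ R B₀` (p539223) is the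
conjunction, under the binders of P2's `FlatOpsAdmPowAt` (every member `F` with `F.L = L`, heights `n < K`, separations `R′ ≥ R₀`, big blocks `M ≥ M₀`, `M = L^a`,
admissible nested families `D` with `D.k = K − n`, the F4 pen's weights), of (hCd) holomorphy of `chartLog η D` on the weighted ball of radius `R`, (hCq) the
quadratic remainder `C₂r²`, and (hH) a ℂ-linear right inverse of `fderiv ℂ (chartLog η D) 0` with the weighted sup letter `B₀`.  This seat proved (hCd) and
(hCq) for EVERY such instance with `R₀ = 2L`, `M₀ = 1` and the k-uniform constants `R⋆ = 1/(12800·(5L)²·L)`, `R = R⋆/4`, `C₂ = 960·5L·L/R⋆` (`d = 3`: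
`chartRemainder_hCd_hCq`).  This file records the reduction: **`chartRemainderAt_of_hH`** — IF the third conjunct (hH) holds under the same binders with letter
`B₀` (the P2↔P3 bridge: P2's `hOp` + the comb-gauge correction, vet G3 (b); NOT proved here), THEN `ChartRemainderAt L (2L) 1 C₂ R B₀`.  So the v8 stub
`stub_chartRemainder : ∀ L > 1, ∃ R₀ M₀ C₂ R B₀, … ∧ ChartRemainderAt L R₀ M₀ C₂ R B₀` is CLOSED MODULO hH.  Sorry-free, definition-free.  NOT a claim about the
mass gap.

References: T. Bałaban, CMP **102** (1985) 277–309 [Balaban1985Variational] ((44)–(48) p.285, (156)–(157) p.302).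
-/

noncomputable section

open scoped BigOperators Matrix.Norms.L2Operator

namespace Summit.QuantumFields.YangMills.Theorems.Prop8Chart

open Literature.MathematicalPhysics.QuantumFieldTheory.Balaban1983to89
open B6SectADomainsV1 (Domains)
open B6SectAOperatorsV1 (BondIdx)
open T3ContinuumYM3Torus (T3Family)
open Summit.QuantumFields.YangMills.Theorems.FlatCubeOpsText (Adm22 IsLevWeight)

/-- **`ChartRemainderAt` FROM ITS THIRD CONJUNCT**: with `R⋆ = (12800·(5L)²·L)⁻¹`, `R = R⋆/4`, `C₂ = 960·(5L)·L/R⋆`, if the weighted right inverse of the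
TRUE linearisation `fderiv ℂ (chartLog η D) 0` exists with letter `B₀` for every member/heights/admissible family/weights (the hH conjunct, hypothesis `hH`), then
`ChartRemainderAt L (2L) 1 C₂ R B₀` — hCd and hCq being theorems (`chartRemainder_hCd_hCq`). [cite: Balaban1985Variational, (44)-(48) p.285, (156)-(157) p.302] -/
theorem chartRemainderAt_of_hH (L : ℕ) (B₀ : ℝ)
    (hH : ∀ (F : T3Family), F.L = L → ∀ (n K : ℕ), n < K → ∀ (R' M : ℕ), 2 * L ≤ R' → 1 ≤ M → (∃ a : ℕ, M = L ^ a) →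
      ∀ (D : Domains (F.P K)), D.k = K - n → Adm22 D R' M →
      ∀ (w : ℕ → PBond (F.P K) 0 → ℝ), IsLevWeight F n K D w →
        ∃ H : (BondIdx D → Matrix (Fin 2) (Fin 2) ℂ) →ₗ[ℂ] (PBond (F.P K) 0 → Matrix (Fin 2) (Fin 2) ℂ),
          (∀ X : BondIdx D → Matrix (Fin 2) (Fin 2) ℂ,
              (fderiv ℂ (chartLog (((F.L : ℝ)⁻¹) ^ (K - n)) D :
                (PBond (F.P K) 0 → Matrix (Fin 2) (Fin 2) ℂ) → BondIdx D → Matrix (Fin 2) (Fin 2) ℂ) 0) (H X) = X) ∧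
          ∀ (X : BondIdx D → Matrix (Fin 2) (Fin 2) ℂ) (t : ℝ), 0 ≤ t → (∀ i, ‖X i‖ ≤ t) → ∀ b, w 1 b * ‖H X b‖ ≤ B₀ * t) :
    ChartRemainderAt L (2 * L) 1
      (960 * (((3 + 2) * L : ℕ) : ℝ) * (L : ℝ) / (12800 * (((3 + 2) * L : ℕ) : ℝ) ^ 2 * (L : ℝ))⁻¹)
      ((12800 * (((3 + 2) * L : ℕ) : ℝ) ^ 2 * (L : ℝ))⁻¹ / 4) B₀ := by
  intro F hF n K hnK R' M hR' hM hpow D hDk hAdm w hw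
  subst hF
  obtain ⟨hd, hq⟩ := chartRemainder_hCd_hCq F n K (R' := R') (M := M) hR' hM D hDk hAdm hw
  exact ⟨hd, hq, hH F rfl n K hnK R' M hR' hM hpow D hDk hAdm w hw⟩

/-- The constants are admissible for the v8 stub shape `∃ R₀ M₀ C₂ R B₀, 0 ≤ C₂ ∧ 0 < R ∧ 0 ≤ B₀ ∧ ChartRemainderAt …`: `0 ≤ C₂` and `0 < R` (`L ≥ 1`).
[cite: Balaban1985Variational, (44) p.285] -/
theorem chartRemainder_constants_pos {L : ℕ} (hL : 1 ≤ L) :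
    0 ≤ 960 * (((3 + 2) * L : ℕ) : ℝ) * (L : ℝ) / (12800 * (((3 + 2) * L : ℕ) : ℝ) ^ 2 * (L : ℝ))⁻¹ ∧
      0 < (12800 * (((3 + 2) * L : ℕ) : ℝ) ^ 2 * (L : ℝ))⁻¹ / 4 := by
  have hL0 : (0 : ℝ) < L := by exact_mod_cast hL
  have h5 : (0 : ℝ) < (((3 + 2) * L : ℕ) : ℝ) := by positivity
  constructor <;> positivity

/-- **THE v8 STUB SHAPE, CLOSED MODULO hH**: for every `L > 1` and `B₀ ≥ 0` carrying the hH conjunct, `∃ R₀ M₀ C₂ R B₀, 0 ≤ C₂ ∧ 0 < R ∧ 0 ≤ B₀ ∧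
ChartRemainderAt L R₀ M₀ C₂ R B₀`. [cite: Balaban1985Variational, (44)-(48) p.285] -/
theorem exists_chartRemainderAt_of_hH (L : ℕ) (hL : 1 < L) (B₀ : ℝ) (hB₀ : 0 ≤ B₀)
    (hH : ∀ (F : T3Family), F.L = L → ∀ (n K : ℕ), n < K → ∀ (R' M : ℕ), 2 * L ≤ R' → 1 ≤ M → (∃ a : ℕ, M = L ^ a) →
      ∀ (D : Domains (F.P K)), D.k = K - n → Adm22 D R' M →
      ∀ (w : ℕ → PBond (F.P K) 0 → ℝ), IsLevWeight F n K D w →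
        ∃ H : (BondIdx D → Matrix (Fin 2) (Fin 2) ℂ) →ₗ[ℂ] (PBond (F.P K) 0 → Matrix (Fin 2) (Fin 2) ℂ),
          (∀ X : BondIdx D → Matrix (Fin 2) (Fin 2) ℂ,
              (fderiv ℂ (chartLog (((F.L : ℝ)⁻¹) ^ (K - n)) D :
                (PBond (F.P K) 0 → Matrix (Fin 2) (Fin 2) ℂ) → BondIdx D → Matrix (Fin 2) (Fin 2) ℂ) 0) (H X) = X) ∧
          ∀ (X : BondIdx D → Matrix (Fin 2) (Fin 2) ℂ) (t : ℝ), 0 ≤ t → (∀ i, ‖X i‖ ≤ t) → ∀ b, w 1 b * ‖H X b‖ ≤ B₀ * t) :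
    ∃ (R₀ M₀ : ℕ) (C₂ R B₀' : ℝ), 0 ≤ C₂ ∧ 0 < R ∧ 0 ≤ B₀' ∧ ChartRemainderAt L R₀ M₀ C₂ R B₀' := by
  obtain ⟨hC, hR⟩ := chartRemainder_constants_pos (L := L) hL.le
  exact ⟨2 * L, 1, _, _, B₀, hC, hR, hB₀, chartRemainderAt_of_hH L B₀ hH⟩

end Summit.QuantumFields.YangMills.Theorems.Prop8Chart

end
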